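import Summits.KontsevichZagierPeriods.Zeta5Search.LaiSweepEval

/-!
# Order-cell sweep certificates for the `κ₃` point, 5/6: what a checked shard proves

HONEST FRAMING. Systematic-search bookkeeping for the `κ₃` point `(74, 2180, 444; δ74)` of
`LaiKappa3Assembly`; no irrationality claim unless certified — this file checks no shard of the `κ₃`
sweep and proves nothing about `ζ(5)`.

`sweep_spec` unrolls a successful `sweep`: the per-cell runtime checks hold (`Good`), the two `ℕ`
accumulators are the exact integer rate sums `cellRateLBNat`/`cellRateUBNat` (`LaiCellRateLB`) of
the produced cells `cellsOf`, and the cells chain from `p/q` to the returned endpoint (`ChainFrom`).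
For a CORRECT regime (`Regime.OK`: cover check, small slopes, `const + Σ ts ≤ φ̃`) the cells are
well formed and admissible for `Kappa3CellCert` (`cellsOf_good`, via `cellEval_sound` and
`LaiKappa3Terms`). `Shard.sound` packages this per shard; `CheckedShard`, `seamOK`, `certCheck`,
`SweepCert`, `cellsL` and the `cellsL_*` lemmas assemble a list of checked shards.

## Main results

* `Sweep.sweep_spec`, `Sweep.cellsOf_good`, `Sweep.Shard.sound`.
* `Sweep.CheckedShard`, `Sweep.certCheck`, `Sweep.SweepCert`, `Sweep.cellsL_good`,
  `Sweep.cellsL_lb`, `Sweep.cellsL_ub`, `Sweep.cellsL_cellChain`.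

Shard files import THIS file: `def shardsNN : List (CheckedShard 128 (2^40)) := [⟨_, shardNNN⟩, …]`.
-/

open Finset Literature.NumberTheory.Transcendental.Zudilin2004
open Literature.NumberTheory.Transcendental.Zudilin2004.PhiCert

namespace Summit.KontsevichZagierPeriods.Zeta5Search

open SavingCheck

namespace Sweep

/-! ### Soundness, VII: the sweep, the shards and the certificate -/

/-- One step of a successful sweep. [folklore] -/
theorem sweep_succ (R : Regime) (K D fuel p q : ℕ) (L : List DTerm) (lb ub : ℕ)
    (h : (sweep R K D (fuel + 1) p q L lb ub).1 = true) :
    0 < (nextBreak R.mods p q).2 ∧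
    SavingCell.WF 434 ⟨(p : ℚ) / q, ((nextBreak R.mods p q).1 : ℚ) / (nextBreak R.mods p q).2,
        (cellEval R.ts R.const p q L).1.toNat⟩ = true ∧
    0 ≤ (cellEval R.ts R.const p q L).1 ∧
    (sweep R K D fuel (nextBreak R.mods p q).1 (nextBreak R.mods p q).2
        (cellEval R.ts R.const p q L).2
        (lb + (cellEval R.ts R.const p q L).1.toNat * SavingCell.densityLBNat
          ⟨(p : ℚ) / q, ((nextBreak R.mods p q).1 : ℚ) / (nextBreak R.mods p q).2,
            (cellEval R.ts R.const p q L).1.toNat⟩ K D)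
        (ub + (cellEval R.ts R.const p q L).1.toNat * SavingCell.densityUBNat
          ⟨(p : ℚ) / q, ((nextBreak R.mods p q).1 : ℚ) / (nextBreak R.mods p q).2,
            (cellEval R.ts R.const p q L).1.toNat⟩ D)).1 = true ∧
    sweep R K D (fuel + 1) p q L lb ub =
      (true, (sweep R K D fuel (nextBreak R.mods p q).1 (nextBreak R.mods p q).2
        (cellEval R.ts R.const p q L).2
        (lb + (cellEval R.ts R.const p q L).1.toNat * SavingCell.densityLBNat
          ⟨(p : ℚ) / q, ((nextBreak R.mods p q).1 : ℚ) / (nextBreak R.mods p q).2,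
            (cellEval R.ts R.const p q L).1.toNat⟩ K D)
        (ub + (cellEval R.ts R.const p q L).1.toNat * SavingCell.densityUBNat
          ⟨(p : ℚ) / q, ((nextBreak R.mods p q).1 : ℚ) / (nextBreak R.mods p q).2,
            (cellEval R.ts R.const p q L).1.toNat⟩ D)).2) := by
  simp only [sweep] at h ⊢
  split at h
  · rename_i n m l w h1 h2 h3 h4
    simp only [Bool.and_eq_true, decide_eq_true_eq] at h
    obtain ⟨⟨hwf, hnn⟩, hrec⟩ := h
    have h3' := Nat.add_right_cancel h3
    have h4' := Nat.add_right_cancel h4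
    rw [h1, h2] at h3' h4' hwf ⊢
    rw [h3', h4']
    refine ⟨m.succ_pos, hwf, hnn, hrec, ?_⟩
    rw [hwf, hrec, decide_eq_true hnn]
    rfl
  · simp at h

/-- The cells produced by the sweep (its specification). [folklore] -/
def cellsOf (R : Regime) : ℕ → ℕ → ℕ → List DTerm → List SavingCell
  | 0, _, _, _ => []
  | fuel + 1, p, q, L =>
      ⟨(p : ℚ) / q, ((nextBreak R.mods p q).1 : ℚ) / (nextBreak R.mods p q).2,
          (cellEval R.ts R.const p q L).1.toNat⟩ ::
        cellsOf R fuel (nextBreak R.mods p q).1 (nextBreak R.mods p q).2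
          (cellEval R.ts R.const p q L).2

/-- The runtime checks of a successful sweep, cell by cell. [folklore] -/
def Good (R : Regime) : ℕ → ℕ → ℕ → List DTerm → Prop
  | 0, _, _, _ => True
  | fuel + 1, p, q, L =>
      (SavingCell.WF 434 ⟨(p : ℚ) / q, ((nextBreak R.mods p q).1 : ℚ) / (nextBreak R.mods p q).2,
          (cellEval R.ts R.const p q L).1.toNat⟩ = true ∧ 0 ≤ (cellEval R.ts R.const p q L).1) ∧
        Good R fuel (nextBreak R.mods p q).1 (nextBreak R.mods p q).2
          (cellEval R.ts R.const p q L).2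

/-- The cells chain from `a` to (at most) `b`: `a ≤ u₁, v₁ ≤ u₂, …, v_k ≤ b`. [folklore] -/
def ChainFrom : ℚ → List SavingCell → ℚ → Prop
  | a, [], b => a ≤ b
  | a, C :: T, b => a ≤ C.u ∧ ChainFrom C.v T b

/-- Chains are monotone in the endpoints. [folklore] -/
theorem ChainFrom.mono : ∀ {a a' : ℚ} {T : List SavingCell} {b b' : ℚ},
    ChainFrom a T b → a' ≤ a → b ≤ b' → ChainFrom a' T b'
  | _, _, [], _, _, h, ha, hb => le_trans ha (le_trans h hb)
  | _, _, _ :: _, _, _, h, ha, hb => ⟨le_trans ha h.1, ChainFrom.mono h.2 le_rfl hb⟩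

/-- Chains concatenate. [folklore] -/
theorem ChainFrom.append : ∀ {a : ℚ} {T₁ : List SavingCell} {b : ℚ} {T₂ : List SavingCell} {c : ℚ},
    ChainFrom a T₁ b → ChainFrom b T₂ c → ChainFrom a (T₁ ++ T₂) c
  | _, [], _, _, _, h₁, h₂ => h₂.mono h₁ le_rfl
  | _, _ :: _, _, _, _, h₁, h₂ => ⟨h₁.1, ChainFrom.append h₁.2 h₂⟩

/-- A chain of cells is a `cellChain`. [folklore] -/
theorem cellChain_of_chainFrom : ∀ {a : ℚ} {T : List SavingCell} {b : ℚ},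
    ChainFrom a T b → cellChain T = true
  | _, [], _, _ => rfl
  | _, [_], _, _ => rfl
  | _, _ :: C' :: rest, b, h => by
      have ih := cellChain_of_chainFrom (T := C' :: rest) (b := b) h.2
      simp only [cellChain, Bool.and_eq_true, decide_eq_true_eq]
      exact ⟨h.2.1, ih⟩

/-- **What a successful sweep computes**: the runtime checks hold, the accumulators are the integer
rate sums of its cells, and the cells chain from `p/q` to the returned endpoint. [folklore] -/
theorem sweep_spec (R : Regime) (K D : ℕ) : ∀ (fuel p q : ℕ) (L : List DTerm) (lb ub : ℕ),
    0 < q → (sweep R K D fuel p q L lb ub).1 = true →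
    Good R fuel p q L ∧
    (sweep R K D fuel p q L lb ub).2.1 = lb + cellRateLBNat (cellsOf R fuel p q L) K D ∧
    (sweep R K D fuel p q L lb ub).2.2.1 = ub + cellRateUBNat (cellsOf R fuel p q L) D ∧
    0 < (sweep R K D fuel p q L lb ub).2.2.2.2 ∧
    ChainFrom ((p : ℚ) / q) (cellsOf R fuel p q L)
      ((((sweep R K D fuel p q L lb ub).2.2.2.1 : ℕ) : ℚ) / (sweep R K D fuel p q L lb ub).2.2.2.2)
  | 0, p, q, L, lb, ub, hq, _ =>
      ⟨trivial, by simp [sweep, cellsOf, cellRateLBNat], by simp [sweep, cellsOf, cellRateUBNat],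
        hq,
        show ((p : ℚ) / q) ≤ (p : ℚ) / q from le_rfl⟩
  | fuel + 1, p, q, L, lb, ub, hq, h => by
      obtain ⟨hv2, hwf, hnn, hrec, heq⟩ := sweep_succ R K D fuel p q L lb ub h
      obtain ⟨hgood, hlb, hub, hqe, hch⟩ := sweep_spec R K D fuel _ _ _ _ _ hv2 hrec
      rw [heq]
      refine ⟨?_, ?_, ?_, hqe, ?_⟩
      · unfold Good; exact ⟨⟨hwf, hnn⟩, hgood⟩
      · show (sweep R K D fuel _ _ _ _ _).2.1 = _
        rw [hlb]; simp only [cellsOf, cellRateLBNat, List.map_cons, List.sum_cons]; omega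
      · show (sweep R K D fuel _ _ _ _ _).2.2.1 = _
        rw [hub]; simp only [cellsOf, cellRateUBNat, List.map_cons, List.sum_cons]; omega
      · show ChainFrom _ (cellsOf R (fuel + 1) p q L)
          ((((sweep R K D fuel _ _ _ _ _).2.2.2.1 : ℕ) : ℚ) / (sweep R K D fuel _ _ _ _ _).2.2.2.2)
        simp only [cellsOf, ChainFrom]
        exact ⟨le_rfl, hch⟩

/-- A regime is CORRECT: its moduli cover the needed ones, its slopes are small, and `const + Σ ts`
minorises `φ̃` at the `κ₃` point on `y ∈ [0, 1)`. [folklore] -/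
structure Regime.OK (R : Regime) : Prop where
  /-- the moduli cover every slope and every difference of jump slopes -/
  cover : coverCheck R.ts R.mods 4805 = true
  /-- all slopes are below `A0` (key packing) -/
  small : ∀ T ∈ R.ts, T.a.natAbs < A0
  /-- `const + Σ ts` minorises `φ̃` at the `κ₃` point for `y ∈ [0, 1)` -/
  link : ∀ x y : ℚ, 0 ≤ y → y < 1 → R.const + evalSum R.ts x y ≤ evalSum laiTerms74 x y

/-- **The cells of a successful sweep of a correct regime are well formed and admissible.**
[cite: Lai2024BallRivoal, §4 Lemma 4.3] -/
theorem cellsOf_good (R : Regime) (hR : R.OK) : ∀ (fuel p q : ℕ) (L : List DTerm), 0 < q →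
    List.Perm (L.map (·.1)) (R.ts.filter isY) → Good R fuel p q L →
    ∀ C ∈ cellsOf R fuel p q L, C.WF 434 = true ∧ C.Adm 74 2180 444 δ74 5
  | 0, _, _, _, _, _, _ => by simp [cellsOf]
  | fuel + 1, p, q, L, hq, hL, hg => by
      obtain ⟨⟨hwf, hnn⟩, hg'⟩ := hg
      have hpos := (cover_of_check hR.cover).1
      have hfree : FreeAll R.ts ((p : ℚ) / q)
          (((nextBreak R.mods p q).1 : ℚ) / (nextBreak R.mods p q).2) :=
        freeAll_of_mods hR.cover fun m hm => free_nextBreak hpos hq hm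
      obtain ⟨hperm, hbound⟩ := cellEval_sound R.ts R.const hq L hL hR.small hfree
      have hv2 : 0 < (nextBreak R.mods p q).2 := (nbAux_spec p q R.mods 1 1 one_pos hpos).1
      intro C hC
      simp only [cellsOf, List.mem_cons] at hC
      rcases hC with rfl | hC
      · refine ⟨hwf, ?_⟩
        intro n P k _ _ _ _ _ _ hmem
        rw [laiPhiDiv_eq_evalSum, laiTerms_evalSum_fract _ _ _ _ two_mul_δ74_le, ← laiTerms74_eq]
        rw [SavingCell.mem_iff] at hmem
        have hfx : Int.fract ((n : ℚ) / P) = ((n % P : ℕ) : ℚ) / P :=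
          Int.fract_div_natCast_eq_div_natCast_mod
        rw [hfx]
        have hb := hbound (((n % P : ℕ) : ℚ) / P) (Int.fract ((k : ℚ) / P)) hmem.1 hmem.2
          (Int.fract_nonneg _) (Int.fract_lt_one _)
        have hl := hR.link (((n % P : ℕ) : ℚ) / P) (Int.fract ((k : ℚ) / P)) (Int.fract_nonneg _)
          (Int.fract_lt_one _)
        simp only
        rw [Int.toNat_of_nonneg hnn]
        linarith
      · exact cellsOf_good R hR fuel _ _ _ hv2 hperm hg' C hC

/-- The cells of a shard. [folklore] -/
def Shard.cells (s : Shard) : List SavingCell := cellsOf s.regime s.n s.p s.q s.regime.L0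

/-- The initial decorated list carries exactly the `y`-terms. [folklore] -/
theorem Regime.L0_perm (R : Regime) : List.Perm (R.L0.map (·.1)) (R.ts.filter isY) := by
  rw [Regime.L0, List.map_map]
  have : ((fun x : DTerm => x.1) ∘ fun T : Term => ((T, 0, 0) : DTerm)) = id := rfl
  rw [this, List.map_id]

/-- **Soundness of a shard**: a shard of a correct regime that checks has well-formed admissible
cells, integer rate sums within the claimed bounds, and cells chaining from `p/q` to `p'/q'`.
[cite: Lai2024BallRivoal, §4 Lemma 4.3] -/
theorem Shard.sound {K D : ℕ} (s : Shard) (hR : s.regime.OK) (h : s.check K D = true) :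
    (∀ C ∈ s.cells, C.WF 434 = true ∧ C.Adm 74 2180 444 δ74 5) ∧
    s.Lo ≤ cellRateLBNat s.cells K D ∧ cellRateUBNat s.cells D ≤ s.Up ∧
    0 < s.q ∧ 0 < s.q' ∧ ChainFrom ((s.p : ℚ) / s.q) s.cells ((s.p' : ℚ) / s.q') := by
  simp only [Shard.check, shardCheck, Bool.and_eq_true, decide_eq_true_eq, beq_iff_eq] at h
  obtain ⟨⟨⟨⟨⟨hq, hq'⟩, hok⟩, hlo⟩, hup⟩, hend⟩ := h
  obtain ⟨hgood, hlb, hub, hqe, hch⟩ := sweep_spec s.regime K D s.n s.p s.q s.regime.L0 0 0 hq hok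
  refine ⟨cellsOf_good s.regime hR s.n s.p s.q _ hq s.regime.L0_perm hgood, ?_, ?_, hq, hq', ?_⟩
  · rw [hlb] at hlo; simpa [Shard.cells] using hlo
  · rw [hub] at hup; simpa [Shard.cells] using hup
  · have hqe' : (0 : ℚ) < (sweep s.regime K D s.n s.p s.q s.regime.L0 0 0).2.2.2.2 := by
      exact_mod_cast hqe
    have hq'' : (0 : ℚ) < s.q' := by exact_mod_cast hq'
    have e : (((sweep s.regime K D s.n s.p s.q s.regime.L0 0 0).2.2.2.1 : ℕ) : ℚ) /
        (sweep s.regime K D s.n s.p s.q s.regime.L0 0 0).2.2.2.2 = (s.p' : ℚ) / s.q' := by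
      rw [div_eq_div_iff hqe'.ne' hq''.ne']
      exact_mod_cast hend
    rw [Shard.cells, ← e]; exact hch

/-! ### The certificate -/

/-- A shard together with its kernel check. [folklore] -/
structure CheckedShard (K D : ℕ) where
  /-- the shard data -/
  s : Shard
  /-- the check evaluated to `true` (by `decide +kernel` in a shard file) -/
  ok : s.check K D = true

/-- Consecutive shards abut or leave a gap: `p'_i/q'_i ≤ p_{i+1}/q_{i+1}` (cross-multiplied).
[folklore] -/
def seamOK : List Shard → Bool
  | [] => true
  | [_] => true
  | s :: t :: rest => decide (s.p' * t.q ≤ t.p * s.q') && seamOK (t :: rest)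

/-- The final check: seams, and the summed integer rate bounds against the two margins.
[folklore] -/
def certCheck (D : ℕ) (L : List Shard) : Bool :=
  seamOK L && decide (0 < D) && decide (38700 * D ≤ (L.map Shard.Lo).sum) &&
    decide ((L.map Shard.Up).sum ≤ 80000 * D)

/-- **Sweep certificate** of the `κ₃` point: checked shards whose seams and summed bounds check.
[cite: Lai2024BallRivoal, §4 Lemma 4.3] -/
structure SweepCert where
  /-- truncation order of the densities -/
  K : ℕ
  /-- fixed denominator of the integer rate sums -/
  D : ℕ
  /-- the checked shards, in increasing order -/
  shards : List (CheckedShard K D)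
  /-- the final check -/
  cert : certCheck D (shards.map (·.s)) = true

/-- All cells of a list of shards. [folklore] -/
def cellsL (L : List Shard) : List SavingCell := L.flatMap Shard.cells

/-- The cells of seam-checked shards chain. [folklore] -/
theorem cellsL_chain (ok : ∀ s : Shard, s.regime.OK) {K D : ℕ} :
    ∀ (cs : CheckedShard K D) (rest : List (CheckedShard K D)),
      seamOK ((cs :: rest).map (·.s)) = true →
      ∃ e, ChainFrom ((cs.s.p : ℚ) / cs.s.q) (cellsL ((cs :: rest).map (·.s))) e
  | cs, [], _ => ⟨_, by simpa [cellsL] using (cs.s.sound (ok _) cs.ok).2.2.2.2.2⟩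
  | cs, ct :: rest, hseam => by
      simp only [List.map_cons, seamOK, Bool.and_eq_true, decide_eq_true_eq] at hseam
      obtain ⟨hst, hseam'⟩ := hseam
      obtain ⟨e, he⟩ := cellsL_chain ok ct rest (by simpa using hseam')
      obtain ⟨_, _, _, _, hq', hchs⟩ := cs.s.sound (ok _) cs.ok
      obtain ⟨_, _, _, hqt, _, _⟩ := ct.s.sound (ok _) ct.ok
      refine ⟨e, ?_⟩
      have hle : (cs.s.p' : ℚ) / cs.s.q' ≤ (ct.s.p : ℚ) / ct.s.q := by
        rw [div_le_div_iff₀ (by exact_mod_cast hq') (by exact_mod_cast hqt)]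
        exact_mod_cast hst
      simp only [cellsL, List.map_cons, List.flatMap_cons] at he ⊢
      exact ChainFrom.append (hchs.mono le_rfl hle) he

/-- The cells of checked shards are well formed and admissible. [folklore] -/
theorem cellsL_good (ok : ∀ s : Shard, s.regime.OK) {K D : ℕ} (L : List (CheckedShard K D)) :
    ∀ C ∈ cellsL (L.map (·.s)), C.WF 434 = true ∧ C.Adm 74 2180 444 δ74 5 := by
  intro C hC
  rw [cellsL, List.mem_flatMap] at hC
  obtain ⟨s, hs, hC⟩ := hC
  obtain ⟨cs, _, rfl⟩ := List.mem_map.1 hs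
  exact (cs.s.sound (ok _) cs.ok).1 C hC

/-- Lower rate sums add up over shards. [folklore] -/
theorem cellsL_lb (ok : ∀ s : Shard, s.regime.OK) {K D : ℕ} : ∀ L : List (CheckedShard K D),
    ((L.map (·.s)).map Shard.Lo).sum ≤ cellRateLBNat (cellsL (L.map (·.s))) K D
  | [] => by simp [cellsL, cellRateLBNat]
  | cs :: L => by
      have ih := cellsL_lb ok L
      simp only [List.map_cons, List.sum_cons, cellsL, List.flatMap_cons, cellRateLBNat_append]
        at ih ⊢
      exact add_le_add (cs.s.sound (ok _) cs.ok).2.1 ih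

/-- Upper rate sums add up over shards. [folklore] -/
theorem cellsL_ub (ok : ∀ s : Shard, s.regime.OK) {K D : ℕ} : ∀ L : List (CheckedShard K D),
    cellRateUBNat (cellsL (L.map (·.s))) D ≤ ((L.map (·.s)).map Shard.Up).sum
  | [] => by simp [cellsL, cellRateUBNat]
  | cs :: L => by
      have ih := cellsL_ub ok L
      simp only [List.map_cons, List.sum_cons, cellsL, List.flatMap_cons, cellRateUBNat_append]
        at ih ⊢
      exact add_le_add (cs.s.sound (ok _) cs.ok).2.2.1 ih

/-- The cells of seam-checked shards form a `cellChain`. [folklore] -/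
theorem cellsL_cellChain (ok : ∀ s : Shard, s.regime.OK) {K D : ℕ} (L : List (CheckedShard K D))
    (h : seamOK (L.map (·.s)) = true) : cellChain (cellsL (L.map (·.s))) = true := by
  cases L with
  | nil => rfl
  | cons cs rest =>
      obtain ⟨e, he⟩ := cellsL_chain ok cs rest h
      exact cellChain_of_chainFrom he

end Sweep

end Summit.KontsevichZagierPeriods.Zeta5Search
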